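/-
Copyright (c) 2026 the pub-hodgecm-mathlib formalisation cell (harness21).  Prover seat hodgecm-mathlib-F0P2-p11 (g0) (L1 re-deal s1969∕s1970, LEAD F0P6-plan (g14)
EMIT #1 «p22» (R1-α)), Track B «K2-LIT» ∕ hLiu418 #184♮, ROAD Φ, G5-b = Φ7-3, organ (R1-α), devices (b1) «per-orbit transport to the standard reflection» and
(b2′) «corner unfolding with an arbitrary character» (sequel of ★ p861153 `K2LiuRankOneUnfolding`).  THEOREMS ONLY.
-/
import Summits.HodgeConjecture.HodgeConjecture.Theorems.K2LiuRankOneUnfolding               -- ★ p861153 (b2): intrinsic corner unfolding (+ ★ FILE C, ★ α2d-2)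
import Summits.HodgeConjecture.HodgeConjecture.Theorems.K2LiuConstantTermMiddleCellPrelims   -- ★ α3-1: `lintegral_orbit_ne_top`, `exists_conj_mulEquiv` (+ ★ α2a)
import Summits.HodgeConjecture.HodgeConjecture.Theorems.K2LiuCoveringWeightTransport         -- ★ α1: transport along `νN`-preserving automorphisms
import HarnessLib

/-!
# Crux `HLiu418`, ROAD Φ, organ Φ7-3 (R1-α), devices (b1) + (b2′): THE TWISTED MIDDLE ORBIT OF `[w₀ p']` TRANSPORTED TO `w₀`, AND THE CORNER
# UNFOLDING WITH AN ARBITRARY CHARACTER — `Σ_{q ∈ O(w₀ p')} ∫ β • (conj ψ_S · f(γ_q u h)) = ∫ β₁(u) • (conj ψ_S(p'⁻¹ u p') · f(w₀ u (p' h))) dνN(u)`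

Cell `hodgecm-mathlib`, crux item hLiu418 = `stmt-HodgeConjecture-24832` (helper lane, count-neutral); squad K2 ∕ K2Liu, LEAD F0P6-plan (g14), desk (R1-α)
K2E5-p17 (g8); prover F0P2-p11 (g0).  THEOREMS ONLY (no `def`, no `instance`, no notation, no named-fact hypothesis, no `sorry`).

WHY (census K2E5-p17 (g7) `CENSUS-G5b-RankOneTermPackage` 4a4be154eb368c66 §0 (b)).  The middle term of the `S`-th coefficient of `E^Δ` concentrates on the
orbit `O(w_χ p')` of the CORNER FRAME `p' ∈ P_Δ(L⁺)` of the rank-one index `S` (★ Φ7-1 (i) `exists_corner_supported_levi` delivers `p'` as a RATIONAL SIEGEL ELEMENT, not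
as a Levi value `Λĝ`).  To feed the orbit into the corner unfolding at the standard reflection `w₀` (★ p861153 `exists_corner_unfold_of_invariant`) one transports
along `u ↦ p' u p'⁻¹` — the ψ_S-TWISTED twin of ★ α3-2 `K2LiuConstantTermMiddleCellGL2.tsum_orbit_reflStd_levi_eq`, for a general rational Siegel `p'`:
* §1 **`tsum_orbit_reflStd_siegel_eq_twisted`** — `νN` left-invariant and preserved by `u ↦ p' u p'⁻¹` (BY VALUE, as in ★ α3-2; ★ (T2) discharges it for Haar `νN`),
  `β` an `N_Δ(L⁺)`-weight, `f` a continuous Siegel section, `Γ₀ = Stab([w₀])` with a `Γ₀`-weight `β₁`, `p' ∈ P_Δ(L⁺)`, `γ₀ = w₀ p'`, the orbit slice of (H) at `h`: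
  `Σ'_{q ∈ O(γ₀)} ∫ β(u) • (conj ψ_S(u) · f(γ_q (u h))) dνN = ∫ β₁(u) • (conj ψ_S(p'⁻¹ u p') · f(w₀ (u (p' h)))) dνN(u)`
  (★ α2a `tsum_orbit_eq_integral_wt_smul` at `Γ' = Stab([γ₀]) = Γ₀.comap(conj p')` with the weight `β₁ ∘ conj p'`; ★ α1 `integral_wt_smul_comp_mulEquiv` ∕
  `lintegral_mul_comp_mulEquiv`; the transported twist is left-`Γ₀`-invariant because `ψ_S` dies on `p'⁻¹ N_Δ(L⁺) p' ⊆ H(L⁺)` (★ `unipDeltaChar_eq_one_of_mem_ratH`),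
  the section because the inducing character dies on `w₀ Γ₀ w₀⁻¹ ⊆ P_Δ(L⁺)` (★ `apply_translate_subgroup_mul`); ★ α3-1 `lintegral_orbit_ne_top` for the `L¹` bound).
* §2 **`exists_corner_unfold_char_section`** — (b2′) the corner unfolding of ★ p861153 for an ARBITRARY twist: `n₂`, `C` of ★ `exists_corner_unfold_of_invariant`
  (SAME constant) and, for every `N_χ(L⁺)`-weight `β₁`, every `ψ : H(𝔸) → ℂ` continuous along `N_Δ(𝔸)` with `ψ(z u) = ψ(u)` (`z ∈ N_χ(𝔸)`, `u ∈ N_Δ(𝔸)`), every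
  continuous Siegel section `f` and every `y`: `∫ β₁(u) • (ψ(u) · f(w₀ (u y))) dνN = C • ∫ ψ(n₂ t) · f(w₀ (n₂ t · y)) dμ` (+ integrability equivalence, + the
  twist-free `[0, ∞]` transport).  The instance `ψ(u) := conj ψ_S(p'⁻¹ u p')` is admissible exactly when `S^{p'}_𝔸` is corner-supported (★
  `unipDeltaChar_eq_one_of_corner` + ★ `stabilizer_iff_corner`): **`conj_unipDeltaChar_conj_invariant`**.
Together with ★ p861153 this closes the analytic part of (R1-α)(b); the assembly (b3) with ★ `integral_rest_eq_tsum_orbit` is bookkeeping over ★ α2d-2.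
References: [MoeglinWaldspurger1995] II.1.7; [KudlaRallis1994] §2 (2.10)–(2.12); [Shimura1997] §18.3; [Tan1999] §3; [GelbartPiatetskishapiroRallis1987] Part A §2;
[CogdellAnalyticTheory2004] §2.3.
HONEST LABEL.  Count-neutral helper: `HC_CM` is proved only modulo the 7 printed citations (2 remaining named inputs: hLiu418 = `stmt-HodgeConjecture-24832`,
h413 = `stmt-HodgeConjecture-24833`) until rung 0 closes.
-/

set_option autoImplicit false
set_option linter.dupNamespace false -- the mandated namespace repeats `HodgeConjecture.HodgeConjecture`

noncomputable section

open scoped Matrix ENNReal NNReal ComplexConjugate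
open NumberField IsDedekindDomain MeasureTheory MeasureTheory.Measure Filter Set Function
open Literature.NumberTheory.Automorphic Literature.NumberTheory.Automorphic.UnitaryGroup Literature.NumberTheory.GaloisRepresentations
open Literature.NumberTheory.GelbartRogawski1991 Literature.NumberTheory.GelbartRogawski1991.GRConstruction
open Literature.NumberTheory.GelbartRogawski1991.AdaptedBlocks
open Literature.NumberTheory.K2Lit.SiegelDoubled Literature.MeasureTheory.Group
open UnitaryDualPair

namespace Summit.HodgeConjecture.HodgeConjecture.Cruxes.HLiu418.K2LiuRankOneOrbitTransport

open K2LiuUnipotentCoveringWeight K2LiuConstantTermBigCellUnfold K2LiuSiegelDoubledUnfold K2LiuSiegelUnipotentFourierDefs K2LiuSiegelUnipotentCharacters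
  K2LiuSiegelEisensteinCoeffOrbitSum K2LiuSiegelBruhatMiddleCellDelta K2LiuSiegelLeviConjUnipDeltaChar K2LiuSiegelMiddleOrbitUnfold K2LiuCoveringWeightTransport
  K2LiuConstantTermMiddleCellPrelims K2LiuSiegelEisensteinCoeffOrbitCriterion K2LiuSiegelMiddleStabilizerCharacter K2LiuSiegelMiddleCellSortedPattern
  K2LiuSiegelMiddleCellLeviCriterion K2LiuRankOneUnfolding

variable {L : Type} [Field L] [NumberField L] [IsCMField L]

section Two

variable {N M : ℕ} {e : Fin N × Fin M ≃ Fin 2}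
  {dV : Fin N → L} {hdV : ∀ i, IsCMField.complexConj L (dV i) = dV i}
  {dW : Fin M → L} {hdW : ∀ i, IsCMField.complexConj L (dW i) = dW i}
variable [MeasurableSpace (unipDelta L e dV hdV dW hdW)] [BorelSpace (unipDelta L e dV hdV dW hdW)]

variable {g₀ : UnitaryGroup.rationalPair (Fp L) L (IsCMField.complexConj L) N M (Matrix.diagonal dV) (Matrix.diagonal dW)}
  (Γ₀ : Subgroup (unipDelta L e dV hdV dW hdW))
  (hΓ₀ : ∀ u : unipDelta L e dV hdV dW hdW, u ∈ Γ₀ ↔ (u : HA L e dV hdV dW hdW) ∈ ratH L e dV hdV dW hdW ∧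
    IsSiegelDelta L e dV hdV dW hdW (iotaGG L e dV hdV dW hdW (1, UnitaryGroup.rationalPairToAdelic (Fp L) L (IsCMField.complexConj L) N M (Matrix.diagonal dV) (Matrix.diagonal dW) g₀) * (u : HA L e dV hdV dW hdW) * (iotaGG L e dV hdV dW hdW (1, UnitaryGroup.rationalPairToAdelic (Fp L) L (IsCMField.complexConj L) N M (Matrix.diagonal dV) (Matrix.diagonal dW) g₀))⁻¹))

/-! ## §1 (b1) The twisted orbit of `[w₀ p']` transported to the standard reflection `w₀` -/

include hΓ₀ in
/-- **THE VALUE OF THE TWISTED MIDDLE ORBIT OF `[w₀ p']`, `p' ∈ P_Δ(L⁺)`.**  `νN` left-invariant on `N_Δ(𝔸)` and preserved by `u ↦ p' u p'⁻¹` (BY VALUE), `β` an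
`N_Δ(L⁺)`-covering weight, `f` a continuous Siegel section of `I_Δ(s, χ)`, `Γ₀ = Stab([w₀])` (membership law), `β₁` a `Γ₀`-covering weight, `γ₀ = w₀ p'`, `S` any index, and the
orbit slice of (H) at `h`.  Then
  `Σ'_{q ∈ O(γ₀)} ∫ β(u) • (conj ψ_S(u) · f(γ_q (u h))) dνN(u) = ∫ β₁(u) • (conj ψ_S(p'⁻¹ u p') · f(w₀ (u (p' h)))) dνN(u)`
(the ψ_S-twisted twin of ★ α3-2 `tsum_orbit_reflStd_levi_eq`, for a general rational Siegel frame). [cite: MoeglinWaldspurger1995, II.1.7] [cite: KudlaRallis1994, §2 (2.10)–(2.12)]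
[cite: CogdellAnalyticTheory2004, §2.3] -/
theorem tsum_orbit_reflStd_siegel_eq_twisted (νN : Measure (unipDelta L e dV hdV dW hdW)) [νN.IsMulLeftInvariant]
    {β : unipDelta L e dV hdV dW hdW → ℝ≥0∞} (hβ : IsCoveringWeight (unipDeltaRat L e dV hdV dW hdW) β)
    {χ : HeckeCharacter L} {s : ℂ} {f : HA L e dV hdV dW hdW → ℂ} (hf : IsSiegelDeltaSection L e dV hdV dW hdW χ s f) (hfc : Continuous f)
    (h : HA L e dV hdV dW hdW) {β₁ : unipDelta L e dV hdV dW hdW → ℝ≥0∞} (hβ₁ : IsCoveringWeight Γ₀ β₁)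
    {p' : HA L e dV hdV dW hdW} (hp'r : p' ∈ ratH L e dV hdV dW hdW) (hp'P : IsSiegelDelta L e dV hdV dW hdW p')
    (hconj : MeasurePreserving (fun u : unipDelta L e dV hdV dW hdW =>
      (⟨p' * (u : HA L e dV hdV dW hdW) * p'⁻¹, by simpa only [inv_inv] using conj_mem_unipDelta L e dV hdV dW hdW (isSiegelDelta_inv L e dV hdV dW hdW hp'P) u.2⟩ :
        unipDelta L e dV hdV dW hdW)) νN νN)
    (S : Matrix (Fin 2) (Fin 2) L)
    (hγ₀ : iotaGG L e dV hdV dW hdW (1, UnitaryGroup.rationalPairToAdelic (Fp L) L (IsCMField.complexConj L) N M (Matrix.diagonal dV) (Matrix.diagonal dW) g₀) * p' ∈ ratH L e dV hdV dW hdW)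
    (hO : ∫⁻ u, (∑' q : ↥(Set.range (fun ν : unipDeltaRat L e dV hdV dW hdW =>
        (Quotient.mk (MulAction.orbitRel (siegelDeltaRat L e dV hdV dW hdW) (ratH L e dV hdV dW hdW))
          ((⟨_, hγ₀⟩ : ratH L e dV hdV dW hdW) * ⟨((ν : unipDelta L e dV hdV dW hdW) : HA L e dV hdV dW hdW), coe_mem_ratH ν⟩)))),
        ‖f (((Quotient.out q.1 : ratH L e dV hdV dW hdW) : HA L e dV hdV dW hdW) * ((u : HA L e dV hdV dW hdW) * h))‖ₑ) * β u ∂νN ≠ ∞) :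
    ∑' q : ↥(Set.range (fun ν : unipDeltaRat L e dV hdV dW hdW =>
        (Quotient.mk (MulAction.orbitRel (siegelDeltaRat L e dV hdV dW hdW) (ratH L e dV hdV dW hdW))
          ((⟨_, hγ₀⟩ : ratH L e dV hdV dW hdW) * ⟨((ν : unipDelta L e dV hdV dW hdW) : HA L e dV hdV dW hdW), coe_mem_ratH ν⟩)))),
      ∫ u, (β u).toReal • (conj (unipDeltaChar L e dV hdV dW hdW S (u : HA L e dV hdV dW hdW) : ℂ) *
        f (((Quotient.out q.1 : ratH L e dV hdV dW hdW) : HA L e dV hdV dW hdW) * ((u : HA L e dV hdV dW hdW) * h))) ∂νN =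
      ∫ u, (β₁ u).toReal • (conj (unipDeltaChar L e dV hdV dW hdW S (p'⁻¹ * (u : HA L e dV hdV dW hdW) * p') : ℂ) *
        f (iotaGG L e dV hdV dW hdW (1, UnitaryGroup.rationalPairToAdelic (Fp L) L (IsCMField.complexConj L) N M (Matrix.diagonal dV) (Matrix.diagonal dW) g₀) *
          ((u : HA L e dV hdV dW hdW) * (p' * h)))) ∂νN := by
  haveI : Countable (unipDeltaRat L e dV hdV dW hdW) := countable_unipDeltaRat L e dV hdV dW hdW
  have hw₀r : iotaGG L e dV hdV dW hdW (1, UnitaryGroup.rationalPairToAdelic (Fp L) L (IsCMField.complexConj L) N M (Matrix.diagonal dV) (Matrix.diagonal dW) g₀) ∈ ratH L e dV hdV dW hdW :=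
    iotaGG_one_mem_ratH L e dV hdV dW hdW g₀
  have hpu : ∀ u : HA L e dV hdV dW hdW, u ∈ unipDelta L e dV hdV dW hdW → p' * u * p'⁻¹ ∈ unipDelta L e dV hdV dW hdW := fun u hu => by
    simpa only [inv_inv] using conj_mem_unipDelta L e dV hdV dW hdW (isSiegelDelta_inv L e dV hdV dW hdW hp'P) hu
  have hpu' : ∀ u : HA L e dV hdV dW hdW, u ∈ unipDelta L e dV hdV dW hdW → p'⁻¹ * u * p' ∈ unipDelta L e dV hdV dW hdW := fun u hu =>
    conj_mem_unipDelta L e dV hdV dW hdW hp'P hu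
  -- the conjugation automorphism `φ = conj(p')` of `N_Δ(𝔸)` (abstractly, through its values)
  obtain ⟨φ, hφ, hφs⟩ := exists_conj_mulEquiv p' hpu hpu'
  have hφfun : (φ : unipDelta L e dV hdV dW hdW → unipDelta L e dV hdV dW hdW) = fun u : unipDelta L e dV hdV dW hdW =>
      (⟨p' * (u : HA L e dV hdV dW hdW) * p'⁻¹, hpu _ u.2⟩ : unipDelta L e dV hdV dW hdW) := funext fun u => Subtype.ext (hφ u)
  have hφsfun : (φ.symm : unipDelta L e dV hdV dW hdW → unipDelta L e dV hdV dW hdW) = fun u : unipDelta L e dV hdV dW hdW =>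
      (⟨p'⁻¹ * (u : HA L e dV hdV dW hdW) * p', hpu' _ u.2⟩ : unipDelta L e dV hdV dW hdW) := funext fun u => Subtype.ext (hφs u)
  have hφm : Measurable (φ : unipDelta L e dV hdV dW hdW → unipDelta L e dV hdV dW hdW) := by
    rw [hφfun]
    exact (Continuous.subtype_mk ((continuous_const.mul continuous_subtype_val).mul continuous_const) _).measurable
  have hφsm : Measurable (φ.symm : unipDelta L e dV hdV dW hdW → unipDelta L e dV hdV dW hdW) := by
    rw [hφsfun]
    exact (Continuous.subtype_mk ((continuous_const.mul continuous_subtype_val).mul continuous_const) _).measurable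
  have hmp : MeasurePreserving φ νN νN := by
    rw [hφfun]
    exact hconj
  -- `Γ' = Stab([w₀ p']) = Γ₀.comap φ`: membership law and the pulled-back weight `β₁ ∘ φ`
  have hΓ'law : ∀ u : unipDelta L e dV hdV dW hdW, u ∈ Γ₀.comap φ.toMonoidHom ↔ (u : HA L e dV hdV dW hdW) ∈ ratH L e dV hdV dW hdW ∧
      IsSiegelDelta L e dV hdV dW hdW ((((⟨_, hγ₀⟩ : ratH L e dV hdV dW hdW)) : HA L e dV hdV dW hdW) * (u : HA L e dV hdV dW hdW) *
        ((((⟨_, hγ₀⟩ : ratH L e dV hdV dW hdW)) : HA L e dV hdV dW hdW))⁻¹) := by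
    intro u
    rw [Subgroup.mem_comap, MulEquiv.coe_toMonoidHom, hΓ₀ (φ u), hφ u, Subtype.coe_mk]
    have hrat : p' * (u : HA L e dV hdV dW hdW) * p'⁻¹ ∈ ratH L e dV hdV dW hdW ↔ (u : HA L e dV hdV dW hdW) ∈ ratH L e dV hdV dW hdW := by
      rw [Subgroup.mul_mem_cancel_right _ (inv_mem hp'r), Subgroup.mul_mem_cancel_left _ hp'r]
    have hassoc : iotaGG L e dV hdV dW hdW (1, UnitaryGroup.rationalPairToAdelic (Fp L) L (IsCMField.complexConj L) N M (Matrix.diagonal dV) (Matrix.diagonal dW) g₀) *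
          (p' * (u : HA L e dV hdV dW hdW) * p'⁻¹) *
          (iotaGG L e dV hdV dW hdW (1, UnitaryGroup.rationalPairToAdelic (Fp L) L (IsCMField.complexConj L) N M (Matrix.diagonal dV) (Matrix.diagonal dW) g₀))⁻¹ =
        iotaGG L e dV hdV dW hdW (1, UnitaryGroup.rationalPairToAdelic (Fp L) L (IsCMField.complexConj L) N M (Matrix.diagonal dV) (Matrix.diagonal dW) g₀) * p' *
          (u : HA L e dV hdV dW hdW) *
          (iotaGG L e dV hdV dW hdW (1, UnitaryGroup.rationalPairToAdelic (Fp L) L (IsCMField.complexConj L) N M (Matrix.diagonal dV) (Matrix.diagonal dW) g₀) * p')⁻¹ := by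
      rw [mul_inv_rev]; simp only [mul_assoc]
    rw [hrat, hassoc]
  have hβ₁' : IsCoveringWeight (Γ₀.comap φ.toMonoidHom) (fun u => β₁ (φ u)) := isCoveringWeight_comp φ hφm Γ₀ hβ₁
  -- α2a (twisted): the orbit sum is one weighted integral against `β₁ ∘ φ`
  rw [tsum_orbit_eq_integral_wt_smul νN hβ hf hfc ⟨_, hγ₀⟩ h S (Γ₀.comap φ.toMonoidHom) hΓ'law hβ₁' hO]
  -- `w₀` as an element `γ₁` of `H(L⁺)`
  obtain ⟨γ₁, hγ₁⟩ : ∃ γ₁ : ratH L e dV hdV dW hdW, (γ₁ : HA L e dV hdV dW hdW) =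
      iotaGG L e dV hdV dW hdW (1, UnitaryGroup.rationalPairToAdelic (Fp L) L (IsCMField.complexConj L) N M (Matrix.diagonal dV) (Matrix.diagonal dW) g₀) :=
    ⟨⟨_, hw₀r⟩, Subtype.coe_mk _ _⟩
  -- the transported integrand `Φ(u) = conj ψ_S(p'⁻¹ u p') · f(γ₁ u (p' h))`; `(conj ψ_S · f(γ₀ · h))(u) = Φ(φ u)`
  obtain ⟨Φ, hΦ⟩ : ∃ Φ : unipDelta L e dV hdV dW hdW → ℂ, ∀ u, Φ u = conj (unipDeltaChar L e dV hdV dW hdW S (p'⁻¹ * (u : HA L e dV hdV dW hdW) * p') : ℂ) *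
      f ((γ₁ : HA L e dV hdV dW hdW) * (u : HA L e dV hdV dW hdW) * (p' * h)) := ⟨_, fun _ => rfl⟩
  have hΦeq : ∀ u : unipDelta L e dV hdV dW hdW,
      conj (unipDeltaChar L e dV hdV dW hdW S (u : HA L e dV hdV dW hdW) : ℂ) * f ((((⟨_, hγ₀⟩ : ratH L e dV hdV dW hdW)) : HA L e dV hdV dW hdW) * (u : HA L e dV hdV dW hdW) * h) =
        Φ (φ u) := by
    intro u
    have harg : (((⟨_, hγ₀⟩ : ratH L e dV hdV dW hdW)) : HA L e dV hdV dW hdW) * (u : HA L e dV hdV dW hdW) * h =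
        (γ₁ : HA L e dV hdV dW hdW) * ((φ u : unipDelta L e dV hdV dW hdW) : HA L e dV hdV dW hdW) * (p' * h) := by
      rw [hφ u, hγ₁, Subtype.coe_mk]
      simp only [mul_assoc, inv_mul_cancel_left]
    have hchar : p'⁻¹ * ((φ u : unipDelta L e dV hdV dW hdW) : HA L e dV hdV dW hdW) * p' = (u : HA L e dV hdV dW hdW) := by
      rw [hφ u]
      simp only [mul_assoc, inv_mul_cancel_left, inv_mul_cancel, mul_one]
    rw [hΦ, hchar, harg]
  -- `Γ₀`-bookkeeping: countable, rational, `w₀ Γ₀ w₀⁻¹ ⊆ P_Δ`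
  have hΓ₀le : Γ₀ ≤ unipDeltaRat L e dV hdV dW hdW := fun u hu => (mem_unipDeltaRat_iff L e dV hdV dW hdW u).2 ((hΓ₀ u).1 hu).1
  haveI : Countable Γ₀ := (Subgroup.inclusion_injective hΓ₀le).countable
  have hΓ₀rat : ∀ γ ∈ Γ₀, ((γ : unipDelta L e dV hdV dW hdW) : HA L e dV hdV dW hdW) ∈ ratH L e dV hdV dW hdW := fun γ hγ => ((hΓ₀ γ).1 hγ).1
  have hΓ₀P : ∀ γ ∈ Γ₀, IsSiegelDelta L e dV hdV dW hdW
      ((γ₁ : HA L e dV hdV dW hdW) * ((γ : unipDelta L e dV hdV dW hdW) : HA L e dV hdV dW hdW) * ((γ₁ : HA L e dV hdV dW hdW))⁻¹) := by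
    intro γ hγ
    rw [hγ₁]
    exact ((hΓ₀ γ).1 hγ).2
  -- the transported integrand: measurable, left-`Γ₀`-invariant (`ψ_S` dies on `p'⁻¹ N_Δ(L⁺) p'`, the section on `w₀ Γ₀ w₀⁻¹`), `L¹` against `β₁`
  have hΦm : StronglyMeasurable Φ := by
    rw [show Φ = fun u : unipDelta L e dV hdV dW hdW => conj (unipDeltaChar L e dV hdV dW hdW S (p'⁻¹ * (u : HA L e dV hdV dW hdW) * p') : ℂ) *
        f ((γ₁ : HA L e dV hdV dW hdW) * (u : HA L e dV hdV dW hdW) * (p' * h)) from funext hΦ]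
    exact (((Complex.continuous_conj.comp (continuous_unipDeltaChar L e dV hdV dW hdW S)).comp
      ((continuous_const.mul continuous_subtype_val).mul continuous_const)).mul
      (hfc.comp ((continuous_const.mul continuous_subtype_val).mul continuous_const))).stronglyMeasurable
  have hΦinv : ∀ γ ∈ Γ₀, ∀ u : unipDelta L e dV hdV dW hdW, Φ (γ * u) = Φ u := by
    intro γ hγ u
    have hsec := apply_translate_subgroup_mul hf γ₁ (p' * h) Γ₀ hΓ₀rat hΓ₀P hγ u
    have hchar : unipDeltaChar L e dV hdV dW hdW S (p'⁻¹ * (((γ * u : unipDelta L e dV hdV dW hdW)) : HA L e dV hdV dW hdW) * p') =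
        unipDeltaChar L e dV hdV dW hdW S (p'⁻¹ * (u : HA L e dV hdV dW hdW) * p') := by
      rw [Subgroup.coe_mul, show p'⁻¹ * (((γ : unipDelta L e dV hdV dW hdW) : HA L e dV hdV dW hdW) * (u : HA L e dV hdV dW hdW)) * p' =
          (p'⁻¹ * ((γ : unipDelta L e dV hdV dW hdW) : HA L e dV hdV dW hdW) * p') * (p'⁻¹ * (u : HA L e dV hdV dW hdW) * p') by
            simp only [mul_assoc, mul_inv_cancel_left],
        unipDeltaChar_mul L e dV hdV dW hdW S (hpu' _ (γ : unipDelta L e dV hdV dW hdW).2) (hpu' _ u.2),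
        unipDeltaChar_eq_one_of_mem_ratH L e dV hdV dW hdW S (mul_mem (mul_mem (inv_mem hp'r) (hΓ₀rat γ hγ)) hp'r), one_mul]
    rw [hΦ, hΦ, hchar, hsec]
  have hint : ∫⁻ u, ‖Φ u‖ₑ * β₁ u ∂νN ≠ ∞ := by
    have hnorm : ∀ u : unipDelta L e dV hdV dW hdW, ‖Φ u‖ₑ = ‖f ((γ₁ : HA L e dV hdV dW hdW) * (u : HA L e dV hdV dW hdW) * (p' * h))‖ₑ := fun u => by
      rw [hΦ, ← ofReal_norm, norm_conj_unipDeltaChar_mul, ofReal_norm]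
    have hFinv : ∀ γ ∈ Γ₀, ∀ u : unipDelta L e dV hdV dW hdW,
        ‖f ((γ₁ : HA L e dV hdV dW hdW) * (((γ * u : unipDelta L e dV hdV dW hdW)) : HA L e dV hdV dW hdW) * (p' * h))‖ₑ =
          ‖f ((γ₁ : HA L e dV hdV dW hdW) * (u : HA L e dV hdV dW hdW) * (p' * h))‖ₑ := fun γ hγ u => by
      rw [apply_translate_subgroup_mul hf γ₁ (p' * h) Γ₀ hΓ₀rat hΓ₀P hγ u]
    have htr := lintegral_mul_comp_mulEquiv νN φ hφm hφsm hmp Γ₀ hβ₁ hβ₁'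
      (F := fun u : unipDelta L e dV hdV dW hdW => ‖f ((γ₁ : HA L e dV hdV dW hdW) * (u : HA L e dV hdV dW hdW) * (p' * h))‖ₑ)
      (measurable_enorm_apply_mul_coe_mul hfc _ _) hFinv
    simp_rw [hnorm]
    rw [← htr]
    refine ne_of_eq_of_ne (lintegral_congr fun u => ?_)
      (lintegral_orbit_ne_top νN hβ hf hfc ⟨_, hγ₀⟩ h (Γ₀.comap φ.toMonoidHom) hΓ'law hβ₁' hO)
    have harg : (γ₁ : HA L e dV hdV dW hdW) * ((φ u : unipDelta L e dV hdV dW hdW) : HA L e dV hdV dW hdW) * (p' * h) =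
        (((⟨_, hγ₀⟩ : ratH L e dV hdV dW hdW)) : HA L e dV hdV dW hdW) * (u : HA L e dV hdV dW hdW) * h := by
      rw [hφ u, hγ₁, Subtype.coe_mk]
      simp only [mul_assoc, inv_mul_cancel_left]
    rw [harg]
  -- transport along `φ` and read off the right-hand side
  calc ∫ u, (β₁ (φ u)).toReal • (conj (unipDeltaChar L e dV hdV dW hdW S (u : HA L e dV hdV dW hdW) : ℂ) *
        f ((((⟨_, hγ₀⟩ : ratH L e dV hdV dW hdW)) : HA L e dV hdV dW hdW) * (u : HA L e dV hdV dW hdW) * h)) ∂νN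
      = ∫ u, ((fun u => β₁ (φ u)) u).toReal • Φ (φ u) ∂νN := by
        refine integral_congr_ae (ae_of_all _ fun u => ?_)
        simp only [hΦeq u]
    _ = ∫ u, (β₁ u).toReal • Φ u ∂νN := integral_wt_smul_comp_mulEquiv νN φ hφm hφsm hmp Γ₀ hβ₁ hβ₁' hΦm hΦinv hint
    _ = _ := by
        refine integral_congr_ae (ae_of_all _ fun u => ?_)
        dsimp only
        rw [hΦ, mul_assoc (γ₁ : HA L e dV hdV dW hdW) (u : HA L e dV hdV dW hdW) (p' * h), hγ₁]

/-! ## §2 (b2′) The corner unfolding at `w₀` with an arbitrary character, for a Siegel section -/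

omit [MeasurableSpace (unipDelta L e dV hdV dW hdW)] [BorelSpace (unipDelta L e dV hdV dW hdW)] in
/-- **THE TRANSPORTED TWIST IS ADMISSIBLE WHEN THE CONJUGATED INDEX IS CORNER-SUPPORTED**: for `p' ∈ P_Δ(𝔸)` with `S^{p'}_𝔸 = E₁ S^{p'}_𝔸 E₁` (★ Φ7-1 (i)
`exists_corner_supported_levi` at the pattern index `k = 1` of `w₀`), `ψ(u) := conj ψ_S(p'⁻¹ u p')` satisfies `ψ(z u) = ψ(u)` for `z ∈ N_χ(𝔸)` (`w₀ z w₀⁻¹ ∈ P_Δ`),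
`u ∈ N_Δ(𝔸)` (★ `unipDeltaChar_eq_one_of_corner`, ★ `stabilizer_iff_corner` at `p' = 1`). [cite: MoeglinWaldspurger1995, II.1.7] [cite: Shimura1997, §18.3] -/
theorem conj_unipDeltaChar_conj_invariant
    (hg₀ : ((g₀ : GL (Fin N × Fin M) L) : Matrix (Fin N × Fin M) (Fin N × Fin M) L) = Matrix.diagonal (fun k => 1 - 2 * (![0, 1] : Fin 2 → L) (e k)))
    {p' : HA L e dV hdV dW hdW} (hp'P : IsSiegelDelta L e dV hdV dW hdW p') (S : Matrix (Fin 2) (Fin 2) L)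
    (hcorner : (Matrix.fromBlocks (1 : Matrix (Fin 2) (Fin 2) (AdeleRing (𝓞 L) L)) 0 (-1) 1 * blk L e dV hdV dW hdW p' * Matrix.fromBlocks 1 0 1 1).toBlocks₂₂ *
          S.map (algebraMap L (AdeleRing (𝓞 L) L)) * (deltaBlock L e dV hdV dW hdW p')⁻¹ =
        Matrix.diagonal (fun i => algebraMap L (AdeleRing (𝓞 L) L) ((![0, 1] : Fin 2 → L) i)) *
          ((Matrix.fromBlocks (1 : Matrix (Fin 2) (Fin 2) (AdeleRing (𝓞 L) L)) 0 (-1) 1 * blk L e dV hdV dW hdW p' * Matrix.fromBlocks 1 0 1 1).toBlocks₂₂ *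
            S.map (algebraMap L (AdeleRing (𝓞 L) L)) * (deltaBlock L e dV hdV dW hdW p')⁻¹) *
          Matrix.diagonal (fun i => algebraMap L (AdeleRing (𝓞 L) L) ((![0, 1] : Fin 2 → L) i)))
    {z : HA L e dV hdV dW hdW} (hz : z ∈ unipDelta L e dV hdV dW hdW)
    (hzP : IsSiegelDelta L e dV hdV dW hdW (iotaGG L e dV hdV dW hdW (1, UnitaryGroup.rationalPairToAdelic (Fp L) L (IsCMField.complexConj L) N M (Matrix.diagonal dV) (Matrix.diagonal dW) g₀) * z * (iotaGG L e dV hdV dW hdW (1, UnitaryGroup.rationalPairToAdelic (Fp L) L (IsCMField.complexConj L) N M (Matrix.diagonal dV) (Matrix.diagonal dW) g₀))⁻¹))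
    {u : HA L e dV hdV dW hdW} (hu : u ∈ unipDelta L e dV hdV dW hdW) :
    conj (unipDeltaChar L e dV hdV dW hdW S (p'⁻¹ * (z * u) * p') : ℂ) = conj (unipDeltaChar L e dV hdV dW hdW S (p'⁻¹ * u * p') : ℂ) := by
  have hgg := mul_self_of_coe_eq_signDiagonal L e dV dW (pattern_std L) hg₀
  -- `p'⁻¹ z p'` is killed by `ψ_S`: its `p'`-conjugate is `z`, whose corner `E₁ X(z) E₁` vanishes (`z ∈ N_χ(𝔸)`, ★ `stabilizer_iff_corner` at `p' = 1`)
  have hzE : Matrix.diagonal (fun i => algebraMap L (AdeleRing (𝓞 L) L) ((![0, 1] : Fin 2 → L) i)) * (blk L e dV hdV dW hdW (p' * (p'⁻¹ * z * p') * p'⁻¹)).toBlocks₁₂ *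
      Matrix.diagonal (fun i => algebraMap L (AdeleRing (𝓞 L) L) ((![0, 1] : Fin 2 → L) i)) = 0 := by
    have h1 := (stabilizer_iff_corner (e := e) (dV := dV) (hdV := hdV) (dW := dW) (hdW := hdW) hg₀ hgg (isSiegelDelta_one' L e dV hdV dW hdW) hz).1
      (by simpa only [mul_one, inv_one] using hzP)
    rw [show p' * (p'⁻¹ * z * p') * p'⁻¹ = 1 * z * 1⁻¹ by group]
    exact h1
  have hkill : unipDeltaChar L e dV hdV dW hdW S (p'⁻¹ * z * p') = 1 :=
    unipDeltaChar_eq_one_of_corner hp'P hcorner (conj_mem_unipDelta L e dV hdV dW hdW hp'P hz) hzE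
  rw [show p'⁻¹ * (z * u) * p' = (p'⁻¹ * z * p') * (p'⁻¹ * u * p') by simp only [mul_assoc, mul_inv_cancel_left],
    unipDeltaChar_mul L e dV hdV dW hdW S (conj_mem_unipDelta L e dV hdV dW hdW hp'P hz) (conj_mem_unipDelta L e dV hdV dW hdW hp'P hu), hkill, one_mul]

/-- **(b2′) THE CORNER UNFOLDING AT `w₀` WITH AN ARBITRARY CHARACTER** (`n₂`, `C` of ★ p861153 `exists_corner_unfold_of_invariant` — SAME constant; `w₀ = ι(1, g₀ ⊗ 1)`): for every
`N_χ(L⁺)`-covering weight `β₁`, every `ψ : H(𝔸) → ℂ` continuous along `N_Δ(𝔸)` with `ψ(z u) = ψ(u)` (`z ∈ N_χ(𝔸)`, `u ∈ N_Δ(𝔸)`), every continuous Siegel section `f` of `I_Δ(s, χ)` and every `y ∈ H(𝔸)`: (i) `∫⁻ ‖f(w₀ (u y))‖ₑ β₁(u) dνN = C · ∫⁻ ‖f(w₀ (n₂ t · y))‖ₑ dμ`; (ii) the integrability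
equivalence and **`∫ β₁(u) • (ψ(u) · f(w₀ (u y))) dνN = C • ∫ ψ(n₂ t) · f(w₀ (n₂ t · y)) dμ`**.  With §1 (`ψ(u) = conj ψ_S(p'⁻¹ u p')`, `y = p' h`,
`conj_unipDeltaChar_conj_invariant`) this is (R1-α)(b) for the corner frame of a rank-one index. [cite: MoeglinWaldspurger1995, II.1.7] [cite: KudlaRallis1994, §2 (2.10)–(2.12)]
[cite: Shimura1997, §18.3] [cite: Tan1999, §3] -/
theorem exists_corner_unfold_char_section (hdV0 : ∀ i, dV i ≠ 0) (hdW0 : ∀ i, dW i ≠ 0)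
    (hg₀ : ((g₀ : GL (Fin N × Fin M) L) : Matrix (Fin N × Fin M) (Fin N × Fin M) L) = Matrix.diagonal (fun k => 1 - 2 * (![0, 1] : Fin 2 → L) (e k)))
    (Λ : GL (Fin 2) (AdeleRing (𝓞 L) L) →* HA L e dV hdV dW hdW)
    (hΛ : ∀ g : GL (Fin 2) (AdeleRing (𝓞 L) L), blk L e dV hdV dW hdW (Λ g) =
      cayR (AdeleRing (𝓞 L) L) (Fin 2) * Matrix.fromBlocks (g : Matrix (Fin 2) (Fin 2) (AdeleRing (𝓞 L) L)) 0 0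
        (((gramR L e dV hdV dW hdW).map ((algebraMap L (AdeleRing (𝓞 L) L)).comp (algebraMap (Fp L) L)))⁻¹ *
          (((g⁻¹ : GL (Fin 2) (AdeleRing (𝓞 L) L)) : Matrix (Fin 2) (Fin 2) (AdeleRing (𝓞 L) L)).map
            (conjAdele (Fp L) L (IsCMField.complexConj L)))ᵀ *
          (gramR L e dV hdV dW hdW).map ((algebraMap L (AdeleRing (𝓞 L) L)).comp (algebraMap (Fp L) L))) *
        cayRinv (AdeleRing (𝓞 L) L) (Fin 2))
    (νN : Measure (unipDelta L e dV hdV dW hdW)) [IsHaarMeasure νN]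
    [MeasurableSpace (AdeleRing (𝓞 (Fp L)) (Fp L))] [BorelSpace (AdeleRing (𝓞 (Fp L)) (Fp L))]
    (μ : Measure (AdeleRing (𝓞 (Fp L)) (Fp L))) [μ.IsAddHaarMeasure] :
    ∃ (n₂ : AdeleRing (𝓞 (Fp L)) (Fp L) → HA L e dV hdV dW hdW) (C : ℝ≥0∞), C ≠ 0 ∧ C ≠ ∞ ∧
      Continuous n₂ ∧ (∀ s t, n₂ (s + t) = n₂ s * n₂ t) ∧ (∀ t, n₂ t ∈ unipDelta L e dV hdV dW hdW) ∧
      (∀ t, (blk L e dV hdV dW hdW (n₂ t)).toBlocks₁₂ =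
        Matrix.single (1 : Fin 2) (1 : Fin 2) (AdeleRing.baseChange (Fp L) L t * algebraMap L (AdeleRing (𝓞 L) L) (imagUnit L))) ∧
      (∀ t : Fp L, n₂ (algebraMap (Fp L) (AdeleRing (𝓞 (Fp L)) (Fp L)) t) ∈ ratH L e dV hdV dW hdW) ∧
      ∀ (Γ₀ : Subgroup (unipDelta L e dV hdV dW hdW))
        (_ : ∀ u : unipDelta L e dV hdV dW hdW, u ∈ Γ₀ ↔ (u : HA L e dV hdV dW hdW) ∈ ratH L e dV hdV dW hdW ∧
          IsSiegelDelta L e dV hdV dW hdW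
            (iotaGG L e dV hdV dW hdW (1, UnitaryGroup.rationalPairToAdelic (Fp L) L (IsCMField.complexConj L) N M (Matrix.diagonal dV) (Matrix.diagonal dW) g₀) *
              (u : HA L e dV hdV dW hdW) *
              (iotaGG L e dV hdV dW hdW (1, UnitaryGroup.rationalPairToAdelic (Fp L) L (IsCMField.complexConj L) N M (Matrix.diagonal dV) (Matrix.diagonal dW) g₀))⁻¹))
        (β₁ : unipDelta L e dV hdV dW hdW → ℝ≥0∞) (_ : IsCoveringWeight Γ₀ β₁)
        {χ : HeckeCharacter L} {s : ℂ} {f : HA L e dV hdV dW hdW → ℂ} (_ : IsSiegelDeltaSection L e dV hdV dW hdW χ s f) (_ : Continuous f)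
        (ψ : HA L e dV hdV dW hdW → ℂ) (_ : Continuous (fun u : unipDelta L e dV hdV dW hdW => ψ (u : HA L e dV hdV dW hdW)))
        (_ : ∀ z : HA L e dV hdV dW hdW, z ∈ unipDelta L e dV hdV dW hdW →
          IsSiegelDelta L e dV hdV dW hdW (iotaGG L e dV hdV dW hdW (1, UnitaryGroup.rationalPairToAdelic (Fp L) L (IsCMField.complexConj L) N M (Matrix.diagonal dV) (Matrix.diagonal dW) g₀) * z * (iotaGG L e dV hdV dW hdW (1, UnitaryGroup.rationalPairToAdelic (Fp L) L (IsCMField.complexConj L) N M (Matrix.diagonal dV) (Matrix.diagonal dW) g₀))⁻¹) →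
          ∀ u : HA L e dV hdV dW hdW, u ∈ unipDelta L e dV hdV dW hdW → ψ (z * u) = ψ u)
        (y : HA L e dV hdV dW hdW),
        ∫⁻ u, ‖f (iotaGG L e dV hdV dW hdW (1, UnitaryGroup.rationalPairToAdelic (Fp L) L (IsCMField.complexConj L) N M (Matrix.diagonal dV) (Matrix.diagonal dW) g₀) * ((u : HA L e dV hdV dW hdW) * y))‖ₑ * β₁ u ∂νN =
          C * ∫⁻ t, ‖f (iotaGG L e dV hdV dW hdW (1, UnitaryGroup.rationalPairToAdelic (Fp L) L (IsCMField.complexConj L) N M (Matrix.diagonal dV) (Matrix.diagonal dW) g₀) * (n₂ t * y))‖ₑ ∂μ ∧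
        (Integrable (fun u : unipDelta L e dV hdV dW hdW => (β₁ u).toReal •
            (ψ (u : HA L e dV hdV dW hdW) * f (iotaGG L e dV hdV dW hdW (1, UnitaryGroup.rationalPairToAdelic (Fp L) L (IsCMField.complexConj L) N M (Matrix.diagonal dV) (Matrix.diagonal dW) g₀) * ((u : HA L e dV hdV dW hdW) * y)))) νN ↔
          Integrable (fun t => ψ (n₂ t) * f (iotaGG L e dV hdV dW hdW (1, UnitaryGroup.rationalPairToAdelic (Fp L) L (IsCMField.complexConj L) N M (Matrix.diagonal dV) (Matrix.diagonal dW) g₀) * (n₂ t * y))) μ) ∧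
        ∫ u, (β₁ u).toReal • (ψ (u : HA L e dV hdV dW hdW) * f (iotaGG L e dV hdV dW hdW (1, UnitaryGroup.rationalPairToAdelic (Fp L) L (IsCMField.complexConj L) N M (Matrix.diagonal dV) (Matrix.diagonal dW) g₀) * ((u : HA L e dV hdV dW hdW) * y))) ∂νN =
          C.toReal • ∫ t, ψ (n₂ t) * f (iotaGG L e dV hdV dW hdW (1, UnitaryGroup.rationalPairToAdelic (Fp L) L (IsCMField.complexConj L) N M (Matrix.diagonal dV) (Matrix.diagonal dW) g₀) * (n₂ t * y)) ∂μ := by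
  obtain ⟨n₂, C, hC0, hCtop, hn₂c, hn₂add, hn₂mem, hn₂X, hn₂rat, hmain⟩ :=
    exists_corner_unfold_of_invariant L e dV hdV dW hdW hdV0 hdW0 hg₀ Λ hΛ νN μ
  refine ⟨n₂, C, hC0, hCtop, hn₂c, hn₂add, hn₂mem, hn₂X, hn₂rat, fun Γ₀ hΓ₀ β₁ hβ₁ χ s f hf hfc ψ hψc hψZ y => ?_⟩
  have hgg : UnitaryGroup.rationalPairToAdelic (Fp L) L (IsCMField.complexConj L) N M (Matrix.diagonal dV) (Matrix.diagonal dW) g₀ *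
      UnitaryGroup.rationalPairToAdelic (Fp L) L (IsCMField.complexConj L) N M (Matrix.diagonal dV) (Matrix.diagonal dW) g₀ = 1 := by
    rw [← map_mul, mul_self_of_coe_eq_signDiagonal L e dV dW (pattern_std L) hg₀, map_one]
  have hw₀inv := reflStd_inv L e dV hdV dW hdW hg₀
  -- the left-`N_χ(𝔸)`-invariance of `x ↦ f (w₀ x)` (★ Φ2 file 4: the inducing character dies on the middle stabilisers)
  have hfZ : ∀ z : HA L e dV hdV dW hdW, z ∈ unipDelta L e dV hdV dW hdW →
      IsSiegelDelta L e dV hdV dW hdW (iotaGG L e dV hdV dW hdW (1, UnitaryGroup.rationalPairToAdelic (Fp L) L (IsCMField.complexConj L) N M (Matrix.diagonal dV) (Matrix.diagonal dW) g₀) * z * (iotaGG L e dV hdV dW hdW (1, UnitaryGroup.rationalPairToAdelic (Fp L) L (IsCMField.complexConj L) N M (Matrix.diagonal dV) (Matrix.diagonal dW) g₀))⁻¹) →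
      ∀ x : HA L e dV hdV dW hdW, f (iotaGG L e dV hdV dW hdW (1, UnitaryGroup.rationalPairToAdelic (Fp L) L (IsCMField.complexConj L) N M (Matrix.diagonal dV) (Matrix.diagonal dW) g₀) * (z * x)) =
        f (iotaGG L e dV hdV dW hdW (1, UnitaryGroup.rationalPairToAdelic (Fp L) L (IsCMField.complexConj L) N M (Matrix.diagonal dV) (Matrix.diagonal dW) g₀) * x) := by
    intro z hz hzP x
    have hX := (isSiegelDelta_conj_unip_iff L e dV hdV dW hdW hgg hz).1 (by rw [hw₀inv] at hzP; exact hzP)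
    obtain ⟨hP, hσ⟩ := reflection_stabilizer_data L e dV hdV dW hdW χ s hgg hz hX
    rw [show iotaGG L e dV hdV dW hdW (1, UnitaryGroup.rationalPairToAdelic (Fp L) L (IsCMField.complexConj L) N M (Matrix.diagonal dV) (Matrix.diagonal dW) g₀) * (z * x) =
        iotaGG L e dV hdV dW hdW (1, UnitaryGroup.rationalPairToAdelic (Fp L) L (IsCMField.complexConj L) N M (Matrix.diagonal dV) (Matrix.diagonal dW) g₀) * z *
          (iotaGG L e dV hdV dW hdW (1, UnitaryGroup.rationalPairToAdelic (Fp L) L (IsCMField.complexConj L) N M (Matrix.diagonal dV) (Matrix.diagonal dW) g₀))⁻¹ *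
          (iotaGG L e dV hdV dW hdW (1, UnitaryGroup.rationalPairToAdelic (Fp L) L (IsCMField.complexConj L) N M (Matrix.diagonal dV) (Matrix.diagonal dW) g₀) * x) by group, hf _ hP, hσ, one_mul]
  obtain ⟨hlin, hboch⟩ := hmain Γ₀ hΓ₀ β₁ hβ₁
  refine ⟨?_, ?_⟩
  · have h1 := hlin (fun x => ‖f (iotaGG L e dV hdV dW hdW (1, UnitaryGroup.rationalPairToAdelic (Fp L) L (IsCMField.complexConj L) N M (Matrix.diagonal dV) (Matrix.diagonal dW) g₀) * (x * y))‖ₑ)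
      (hfc.comp (continuous_const.mul (continuous_subtype_val.mul continuous_const))).measurable.enorm (fun z hz hzP u _ => by
        show ‖f (iotaGG L e dV hdV dW hdW (1, UnitaryGroup.rationalPairToAdelic (Fp L) L (IsCMField.complexConj L) N M (Matrix.diagonal dV) (Matrix.diagonal dW) g₀) * (z * u * y))‖ₑ =
          ‖f (iotaGG L e dV hdV dW hdW (1, UnitaryGroup.rationalPairToAdelic (Fp L) L (IsCMField.complexConj L) N M (Matrix.diagonal dV) (Matrix.diagonal dW) g₀) * (u * y))‖ₑ
        rw [mul_assoc z u y, hfZ z hz hzP])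
    exact (lintegral_congr fun u => mul_comm _ _).trans h1
  · refine hboch (fun x => ψ x * f (iotaGG L e dV hdV dW hdW (1, UnitaryGroup.rationalPairToAdelic (Fp L) L (IsCMField.complexConj L) N M (Matrix.diagonal dV) (Matrix.diagonal dW) g₀) * (x * y))) ?_ ?_
    · exact hψc.mul (hfc.comp (continuous_const.mul (continuous_subtype_val.mul continuous_const)))
    · intro z hz hzP u hu
      show ψ (z * u) * f (iotaGG L e dV hdV dW hdW (1, UnitaryGroup.rationalPairToAdelic (Fp L) L (IsCMField.complexConj L) N M (Matrix.diagonal dV) (Matrix.diagonal dW) g₀) * (z * u * y)) =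
        ψ u * f (iotaGG L e dV hdV dW hdW (1, UnitaryGroup.rationalPairToAdelic (Fp L) L (IsCMField.complexConj L) N M (Matrix.diagonal dV) (Matrix.diagonal dW) g₀) * (u * y))
      rw [hψZ z hz hzP u hu, mul_assoc z u y, hfZ z hz hzP]

end Two

end Summit.HodgeConjecture.HodgeConjecture.Cruxes.HLiu418.K2LiuRankOneOrbitTransport

end
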